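import Summits.RiemannHypothesis.RiemannHypothesis.Theses.WeilParity
import Summits.RiemannHypothesis.RiemannHypothesis.Theorems.WeilParityOffLineParityDetectionStubOddOnLineUpperBound
import Summits.RiemannHypothesis.RiemannHypothesis.Theorems.WeilParityOffLineParityDetectionStubRealEvenSuffices
import Literature.NumberTheory.LFunctions.WeilGroundEnergyParitySplit
import Literature.NumberTheory.LFunctions.WeilZeroSum
import HarnessLib

/-!
# Line `dirichlet-coherent-window` — strategist's ALTERNATIVE skeleton for crux `OffLineParityDetection` (stmt-RiemannHypothesis-15431)

Crux (route `WeilParity`, rank 2): an off-line zero of `ζ` makes the ODD Weil sector strictly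
undercut the EVEN sector at some window `a > 0`.

This line keeps the lead's outer frame (realification + the finite / infinite defect dichotomy) and
REPLACES the lead's cut of the FINITE case (`EVEN-CS` + `TRIAL` under a strictly-dominant-quadruple
hypothesis + the open `RESONANT` residue) by ONE ζ-free mechanism that needs no dominance hypothesis:

**Dirichlet coherent windows.**  Synchronise ALL off-line ordinates at once: by simultaneous
Dirichlet approximation there are arbitrarily large `a₀` with `γ a₀ ≡ 0 (mod π)` up to `ε` for every
ordinate `γ` of the (finite) configuration.  During the next quarter of the fastest period,
`a = a₀ + s`, `0 < s ≤ π/(2 γ_max)`, EVERY off-line quadruple sits in its odd-favourable phase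
simultaneously (single-quadruple splitting `∝ e^{2ηa} cos(2γa - arg(η+iγ))`, positive exactly for
`2γ s ∈ (0, π)` up to `O(η/γ)`), so the odd sector wins by the full coherent sum of the splittings and
no competitor can interfere destructively — there is no "resonant" case left.  Numerics (strategist
folder `numerics/`, pure closed forms): in the exact finite-rank model of the two sector bottoms the
relative splitting at `a₀ + π/(4γ_max)` is `> 0` in 300/300 random configurations (generic,
harmonic ladders `γ_k = kγ₁` where the hull has NO antipodal symmetry and odd wins on only `17–36 %`
of windows, close ordinates `Δγ < η`, mixed offsets, multiplicities `1–4`) and coincides with the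
GLOBAL maximum of the splitting over all windows (e.g. `+1.07e-2` vs max `+1.10e-2`, `J = 2`,
`η = 0.1`, `γ = 30, 30√2`; `+6.46e-2` vs `+6.49e-2` for the 6-ladder).

## The cut

* landed (imported, used as theorems): REAL `stub_realEvenSuffices`, ODD-ON `stub_oddOnLineUpperBound`
  (Theorems/WeilParityOffLineParityDetectionStub{RealEvenSuffices,OddOnLineUpperBound}.lean).
* `stub_evenOffLineLowerBound` (EVEN-LOW, verbatim the lead's stub; M): `Σ_{ρ∈S} m Re ê(ρ)² ≤ Re Q(e)`
  for real even `e` (drop the non-negative on-line terms of the zero-side form).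
* `stub_simultaneousDirichlet` (DIRICHLET; M, Mathlib pigeonhole): for a finite set of reals `F`,
  every `ε > 0` and every `A` there is `a ≥ A` with `γ a` within `ε` of `πℤ` for all `γ ∈ F`.
* `stub_oddWinsAfterCommonPeriod` (COH-SYNC; L–XL, pure real/harmonic analysis, ζ-free — the
  load-bearing stub): for a finite weighted configuration `(T, w)` with one strictly weighted
  off-line point and any constant `Z`, there are `ε > 0` and `A` such that after EVERY `ε`-synchronised
  `a₀ ≥ A` some window `a > 0` carries a real odd test `o ≠ 0` and a threshold `x` with
  `(‖o‖₁+‖o″‖₁)² Z - Σ_T w Re ô(ρ)² < x ∫|o|²` and `x ≤ Σ_T w Re ê(ρ)²` for every real even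
  normalised `e` on `[-a, a]` (the TRUE even off-line infimum, not the Cauchy–Schwarz sum).
* `stub_infiniteDefectDetection` (INF, verbatim the lead's; XL open core — untouched by this line).

`OffLineParityDetection_of` (sorry-free): `S` infinite ⇒ INF; `S` finite and nonempty ⇒
`finiteDefectDetection_of`: `T = S`, `w = m` (`m(ρ₀) > 0`, `m ≥ 0`), `Z = Σ m/(1+γ²)²`; COH-SYNC
gives `ε, A`; DIRICHLET on `F = im '' S` gives a synchronised `a₀ ≥ A`; COH-SYNC then gives `a, o, x`;
ODD-ON bounds `Re Q(o)` by the left side, so `ε_od(a) ∫|o|² ≤ Re Q(o) < x ∫|o|²`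
(`weilOddGroundEnergy_mul_le_re`), i.e. `ε_od(a) < x`; EVEN-LOW gives `x ≤ Re Q(e)` on real even
normalised tests; then, exactly as the lead: `exists_lt_of_csInf_lt` on the odd sphere, REAL (landed)
transfers to complex even tests, margin `m = x - Re Q(o)`.

Disproof used: none on file (`ledger crux ls stmt-RiemannHypothesis-15431`, 2026-08-17T09:xxZ:
Lines/birth.{lean,md}, PICKED.md). Negatives index: nothing on this crux.
-/

set_option linter.dupNamespace false

noncomputable section

namespace Summit.RiemannHypothesis.RiemannHypothesis.Cruxes.OffLineParityDetection.DirichletCoherentWindow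

open MeasureTheory Set
open scoped ComplexConjugate
open Literature.NumberTheory.LFunctions
open Summit.RiemannHypothesis.RiemannHypothesis.Theses.WeilParity (OffLineParityDetection)
open Summit.RiemannHypothesis.RiemannHypothesis.Theorems.WeilParityOffLineParityDetection
  (stub_realEvenSuffices stub_oddOnLineUpperBound)

/-! ### Registered stubs -/

/-- Stub **EVEN-LOW** (verbatim the lead's `stub_evenOffLineLowerBound`; provable now; M): for a
REAL-valued EVEN Weil test `e` and the finite set `S` of off-line zeros, the off-line part of the
zero side bounds `Re Q(e)` from below: `Σ_{ρ ∈ S} m(ρ) Re ê(ρ)² ≤ Re Q(e)`.  Mechanism: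
`Q(e) = WeilConverse.zeroForm e = Σ_ρ m(ρ) P_e(ρ)` (absolutely convergent, equal to `weilQuadratic e`
by `WeilConverse.hasWeilZeroSide_zeroForm` + `explicit_formula_holds`), `P_e(ρ) = ê(ρ)²`
(`stub_evenTransfer_pairCoeff`), and on the critical line `P_e(ρ) = |ê(ρ)|² ≥ 0`, so dropping every
zero outside `S` only decreases the sum. [cite: Bombieri2000Weil, §3 Thm. 1 (zero-side form); Weil1952] -/
theorem stub_evenOffLineLowerBound :
    ∀ e : ℝ → ℂ, IsWeilTest e → (∀ t, e (-t) = e t) → (∀ t, (e t).im = 0) →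
      ∀ hS : ({ρ : ℂ | riemannZeta ρ = 0 ∧ 0 < ρ.re ∧ ρ.re < 1 ∧ ρ.re ≠ 1 / 2}).Finite,
        ∑ ρ ∈ hS.toFinset, (riemannZetaZeroOrder ρ : ℝ) * ((weilMellin e ρ) ^ 2).re ≤
          (weilQuadratic e).re := by
  sorry

/-- Stub **DIRICHLET** (simultaneous Dirichlet approximation, recurrence form; M): for a finite set
`F` of real frequencies, every `ε > 0` and every `A`, some `a ≥ A` has `γ a` within `ε` of `πℤ` for
all `γ ∈ F` simultaneously.  Mechanism: pigeonhole on the torus `(ℝ/πℤ)^F` for the multiples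
`k a₁`, `k = 0, …, N^{|F|}` of any `a₁ ≥ max A 1` (two multiples fall in one of the `N^{|F|}` boxes of
side `π/N < ε`; their difference `(k - k') a₁ ≥ a₁ ≥ A` works), cf. Mathlib's one-dimensional
`Real.exists_int_int_abs_mul_sub_le` / `Finset.exists_ne_map_eq_of_card_lt_of_maps_to`.
[cite: HardyWright, Thm. 200 (simultaneous approximation); folklore] -/
theorem stub_simultaneousDirichlet :
    ∀ (F : Finset ℝ) (ε : ℝ), 0 < ε → ∀ A : ℝ, ∃ a : ℝ, A ≤ a ∧
      ∀ γ ∈ F, ∃ n : ℤ, |γ * a - n * Real.pi| < ε := by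
  sorry

/-- Stub **COH-SYNC** — *the odd sector wins a quarter fast-period after a common near-period*
(pure real/harmonic analysis, ζ-free; L–XL; the load-bearing stub of this line).  Let `T` be a finite
set of points with weights `w ≥ 0`, and `ρ₀ ∈ T` off the line (`Re ρ₀ ≠ 1/2`) with `w ρ₀ > 0`.  Then
for every real `Z` there are `ε > 0` and `A` such that for EVERY `a₀ ≥ A` at which all ordinates are
`ε`-synchronised (`(Im ρ) a₀ ∈ πℤ + (-ε, ε)` for all `ρ ∈ T`) there exist a window `a > 0` (in the
proof: `a = a₀ + s`, `s ≍ π/(4 max|Im ρ|)`), a REAL ODD Weil test `o ≠ 0` on `[-a, a]` and a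
threshold `x` with
  `(‖o‖₁ + ‖o″‖₁)² Z - Σ_{ρ∈T} w(ρ) Re ô(ρ)² < x ∫|o|²`   and
  `x ≤ Σ_{ρ∈T} w(ρ) Re ê(ρ)²` for every REAL EVEN `L²`-normalised Weil test `e` on `[-a, a]`.
Mechanism (`ρ = 1/2 + η + iγ`; for real tests `Re ê(ρ)² = (∫e cosh(ηt)cos(γt))² - (∫e sinh(ηt)sin(γt))²`,
`-Re ô(ρ)² = (∫o cosh(ηt)sin(γt))² - (∫o sinh(ηt)cos(γt))²`): both sides are governed by ONE
indefinite finite-rank form on profiles `f ∈ L²[0, a]`,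
`Ψ_a(f) = Σ w Re (∫₀ᵃ f(t) e^{(η+iγ)t} dt)²` — the odd bottom of the off-line form is `-2 λ_max(Ψ_a)`,
the even bottom `2 λ_min(Ψ_a)`, up to `O(a e^{-ηa})` relative — and `Ψ_a ∘ (f ↦ "if")` flips sign, so
to leading order `λ_max + λ_min = 0` (parity symmetry of the hull); the first-order splitting is
`sign Re ∫₀ᵃ φ*(t)² dt` for the complexified optimiser `φ* = Σ α_k e^{(η_k+iγ_k)t}`, i.e. odd wins iff
the optimal profile outweighs its quadrature partner.  At `a = a₀ + s` with all `γ_k a₀ ≡ 0 (π)` every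
kernel `e^{iγ_k(t-a₀)}` is REAL at the common instant `t = a₀` and in the first quadrant on
`[a₀, a₀+s]`, `s ≤ π/(2γ_max)`, where the weight `e^{2ηt}` is largest: each quadruple's own splitting
`(η_k/|η_k+iγ_k|) sin(2γ_k s + O(η/γ))` is positive SIMULTANEOUSLY, while a common instant at which
all kernels are imaginary (the even-favourable configuration) need not exist on the hull (it fails
already for `γ₂ = 2γ₁`).  The dominant-quadruple case (`J = 1`) is the lead's TRIAL computation
(`χ(t) sinh(η₀t) cos(γ₀t)` at phase `2γ₀a + arctan(η₀/γ₀) ≡ π/2`); lower-offset points are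
exponentially subdominant; on-line points of `T` cost `O(a)·w` against an `e^{2ηa}` gain.  Evidence:
strategist numerics (closed-form Gram model, 300/300 configurations incl. harmonic ladders and
`Δγ < η`; the synchronised quarter-period window realises the global maximum of the splitting).
WHY IT MIGHT FAIL: the multi-point coupling (cross-Gram entries `~ e^{2ηa}/|γ_j - γ_k|`, larger than the
splitting `~ e^{2ηa} η/γ²…e^{2ηa}/γ` when ordinates are close) is controlled only numerically and to
first order in `η/γ`; a rigorous proof needs either a perturbation argument with explicit constants
or a positivity structure (Cauchy-matrix `[sin((γ_j+γ_k)s)/(γ_j+γ_k)]`) not yet isolated.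
[cite: Bombieri2000Weil, Thm. 8 and §13 (one negative eigenvalue per sector per fake quadruple); folklore] -/
theorem stub_oddWinsAfterCommonPeriod :
    ∀ (T : Finset ℂ) (w : ℂ → ℝ) (ρ₀ : ℂ), ρ₀ ∈ T → ρ₀.re ≠ 1 / 2 → 0 < w ρ₀ →
      (∀ ρ ∈ T, 0 ≤ w ρ) →
      ∀ Z : ℝ, ∃ ε : ℝ, 0 < ε ∧ ∃ A : ℝ, ∀ a₀ : ℝ, A ≤ a₀ →
        (∀ ρ ∈ T, ∃ n : ℤ, |ρ.im * a₀ - n * Real.pi| < ε) →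
        ∃ a : ℝ, 0 < a ∧ ∃ o : ℝ → ℂ, IsWeilTest o ∧ tsupport o ⊆ Set.Icc (-a) a ∧
          (∀ t, o (-t) = -o t) ∧ (∀ t, (o t).im = 0) ∧ 0 < ∫ t, ‖o t‖ ^ 2 ∧
          ∃ x : ℝ,
            ((∫ t, ‖o t‖) + ∫ t, ‖deriv (deriv o) t‖) ^ 2 * Z -
                ∑ ρ ∈ T, w ρ * ((weilMellin o ρ) ^ 2).re < x * ∫ t, ‖o t‖ ^ 2 ∧
            ∀ e : ℝ → ℂ, IsWeilTest e → tsupport e ⊆ Set.Icc (-a) a → (∀ t, e (-t) = e t) →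
              (∀ t, (e t).im = 0) → ∫ t, ‖e t‖ ^ 2 = (1 : ℝ) →
              x ≤ ∑ ρ ∈ T, w ρ * ((weilMellin e ρ) ^ 2).re := by
  sorry

/-- Stub **INF** (verbatim the lead's `stub_infiniteDefectDetection`; the XL open core of the crux,
NOT addressed by this line): if the set of off-line zeros of `ζ` in the critical strip is INFINITE,
then at some window `a > 0` a real threshold `x` separates `ε_od(a) < x` from every REAL-valued even
normalised Weil test on `[-a, a]`.  (Strategist census, §Decomposition: the ascending sub-case — offset
supremum approached only along heights `→ ∞` — has no known lever; see STRATEGY-CENSUS.md.)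
[cite: Bombieri2000Weil, Thm. 8, §11, §13; ConnesSuijlekom2025] -/
theorem stub_infiniteDefectDetection :
    ({ρ : ℂ | riemannZeta ρ = 0 ∧ 0 < ρ.re ∧ ρ.re < 1 ∧ ρ.re ≠ 1 / 2}).Infinite →
      ∃ a : ℝ, 0 < a ∧ ∃ x : ℝ, weilOddGroundEnergy a < x ∧
        ∀ e : ℝ → ℂ, IsWeilTest e → tsupport e ⊆ Set.Icc (-a) a → (∀ t, e (-t) = e t) →
          (∀ t, (e t).im = 0) → ∫ t, ‖e t‖ ^ 2 = (1 : ℝ) → x ≤ (weilQuadratic e).re := by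
  sorry

/-! ### Stub statements by name (`type_of%` abbrevs, as in the lead's skeleton) -/

namespace Statement

/-- Statement of `stub_evenOffLineLowerBound`. -/
abbrev stub_evenOffLineLowerBound : Prop :=
  type_of% @DirichletCoherentWindow.stub_evenOffLineLowerBound
/-- Statement of `stub_simultaneousDirichlet`. -/
abbrev stub_simultaneousDirichlet : Prop :=
  type_of% @DirichletCoherentWindow.stub_simultaneousDirichlet
/-- Statement of `stub_oddWinsAfterCommonPeriod`. -/
abbrev stub_oddWinsAfterCommonPeriod : Prop :=
  type_of% @DirichletCoherentWindow.stub_oddWinsAfterCommonPeriod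
/-- Statement of `stub_infiniteDefectDetection`. -/
abbrev stub_infiniteDefectDetection : Prop :=
  type_of% @DirichletCoherentWindow.stub_infiniteDefectDetection

end Statement

/-! ### The finite-defect detection from EVEN-LOW, DIRICHLET, COH-SYNC and the landed ODD-ON -/

/-- **FIN from EVEN-LOW, DIRICHLET, COH-SYNC (+ landed ODD-ON)** (sorry-free), with NO case
distinction dominant / resonant: if the off-line set `S` is finite and nonempty then at some window
`a > 0` a threshold `x` has `ε_od(a) < x ≤ Re Q(e)` for every real even normalised test `e` on
`[-a, a]`.  `T = S`, `w = m` (`m(ρ₀) > 0` by `riemannZetaZeroOrder_pos_iff`, `m ≥ 0` by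
`riemannZetaZeroOrder_nonneg`), `Z = Σ_ρ m(ρ)/(1+γ²)²`; COH-SYNC gives `ε, A`; DIRICHLET on the
ordinates `im '' S` gives a synchronised `a₀ ≥ A`; COH-SYNC gives `a, o, x`; ODD-ON bounds `Re Q(o)`
by the left side of the COH-SYNC inequality, so `ε_od(a) ∫|o|² ≤ Re Q(o) < x ∫|o|²`
(`weilOddGroundEnergy_mul_le_re`); EVEN-LOW gives `x ≤ Re Q(e)`. [folklore] -/
theorem finiteDefectDetection_of (hLow : Statement.stub_evenOffLineLowerBound)
    (hDir : Statement.stub_simultaneousDirichlet) (hCoh : Statement.stub_oddWinsAfterCommonPeriod) :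
    ({ρ : ℂ | riemannZeta ρ = 0 ∧ 0 < ρ.re ∧ ρ.re < 1 ∧ ρ.re ≠ 1 / 2}).Finite →
      (∃ ρ : ℂ, riemannZeta ρ = 0 ∧ 0 < ρ.re ∧ ρ.re < 1 ∧ ρ.re ≠ 1 / 2) →
      ∃ a : ℝ, 0 < a ∧ ∃ x : ℝ, weilOddGroundEnergy a < x ∧
        ∀ e : ℝ → ℂ, IsWeilTest e → tsupport e ⊆ Set.Icc (-a) a → (∀ t, e (-t) = e t) →
          (∀ t, (e t).im = 0) → ∫ t, ‖e t‖ ^ 2 = (1 : ℝ) → x ≤ (weilQuadratic e).re := by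
  intro hS hne
  classical
  obtain ⟨ρ₀, hρ₀⟩ := hne
  have hne1 : ∀ ρ ∈ hS.toFinset, ρ ≠ 1 := fun ρ hρ h1 ↦ by
    have h := (hS.mem_toFinset.1 hρ).2.2.1
    rw [h1, Complex.one_re] at h
    exact lt_irrefl _ h
  have hρ₀T : ρ₀ ∈ hS.toFinset := hS.mem_toFinset.2 hρ₀
  have hw₀ : 0 < (riemannZetaZeroOrder ρ₀ : ℝ) := by
    exact_mod_cast (riemannZetaZeroOrder_pos_iff (hne1 ρ₀ hρ₀T)).2 hρ₀.1
  have hw : ∀ ρ ∈ hS.toFinset, 0 ≤ (riemannZetaZeroOrder ρ : ℝ) := fun ρ hρ ↦ by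
    exact_mod_cast riemannZetaZeroOrder_nonneg (hne1 ρ hρ)
  -- COH-SYNC: the synchronisation precision `ε` and the threshold `A` for this configuration
  obtain ⟨ε, hε, A, hA⟩ :=
    hCoh hS.toFinset (fun ρ ↦ (riemannZetaZeroOrder ρ : ℝ)) ρ₀ hρ₀T hρ₀.2.2.2 hw₀ hw
      (∑' ρ : ZetaZeros.riemannZetaNontrivialZeros, weilZeroWeight (ρ : ℂ))
  -- DIRICHLET: a synchronised `a₀ ≥ A` for the finitely many ordinates
  obtain ⟨a₀, hAa₀, hsync⟩ := hDir (hS.toFinset.image Complex.im) ε hε A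
  have hsyncT : ∀ ρ ∈ hS.toFinset, ∃ n : ℤ, |ρ.im * a₀ - n * Real.pi| < ε :=
    fun ρ hρ ↦ hsync ρ.im (Finset.mem_image_of_mem Complex.im hρ)
  obtain ⟨a, ha, o, ho, hos, hodd, horeal, hN, x, hlt, hxe⟩ := hA a₀ hAa₀ hsyncT
  refine ⟨a, ha, x, ?_, fun e he hes hev hreal hen ↦
    (hxe e he hes hev hreal hen).trans (hLow e he hev hreal hS)⟩
  have hQo := stub_oddOnLineUpperBound o ho hodd horeal hS
  have hmul : weilOddGroundEnergy a * ∫ t, ‖o t‖ ^ 2 ≤ (weilQuadratic o).re :=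
    weilOddGroundEnergy_mul_le_re ho hos hodd
  exact lt_of_mul_lt_mul_right ((hmul.trans hQo).trans_lt hlt) hN.le

/-! ### The crux from the stubs (kernel-checked composition, no `sorry`) -/

/-- **The crux BY NAME from the four stub statements** (EVEN-LOW, DIRICHLET, COH-SYNC, INF →
`WeilParity.OffLineParityDetection`), with the LANDED REAL and ODD-ON used as theorems: given an
off-line zero `ρ`, the off-line set `S` is nonempty; `Set.finite_or_infinite S` selects
`finiteDefectDetection_of` or INF and yields a window `a > 0` and a threshold `x` with
`ε_od(a) < x ≤ Re Q` on real even normalised tests; `ε_od(a)` is the infimum of the (nonempty) odd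
sphere, so some odd normalised `o` has `Re Q(o) < x` (`exists_lt_of_csInf_lt`); REAL (landed
`stub_realEvenSuffices`) transfers the even bound to complex even tests; margin `m = x − Re Q(o)`.
[folklore] -/
theorem OffLineParityDetection_of (hLow : Statement.stub_evenOffLineLowerBound)
    (hDir : Statement.stub_simultaneousDirichlet) (hCoh : Statement.stub_oddWinsAfterCommonPeriod)
    (hInf : Statement.stub_infiniteDefectDetection) : OffLineParityDetection := by
  intro ρ hζ h0 h1 hne
  obtain ⟨a, ha, x, hox, hb⟩ : ∃ a : ℝ, 0 < a ∧ ∃ x : ℝ, weilOddGroundEnergy a < x ∧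
      ∀ e : ℝ → ℂ, IsWeilTest e → tsupport e ⊆ Set.Icc (-a) a → (∀ t, e (-t) = e t) →
        (∀ t, (e t).im = 0) → ∫ t, ‖e t‖ ^ 2 = (1 : ℝ) → x ≤ (weilQuadratic e).re := by
    rcases ({ρ : ℂ | riemannZeta ρ = 0 ∧ 0 < ρ.re ∧ ρ.re < 1 ∧ ρ.re ≠ 1 / 2}).finite_or_infinite
      with hS | hS
    · exact finiteDefectDetection_of hLow hDir hCoh hS ⟨ρ, hζ, h0, h1, hne⟩
    · exact hInf hS
  rw [weilOddGroundEnergy_eq_sInf] at hox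
  obtain ⟨y, ⟨o, ho, hos, hodd, hon, rfl⟩, hlt⟩ :=
    exists_lt_of_csInf_lt (weilWindowSphereValues_odd_nonempty ha) hox
  refine ⟨a, ha, o, ho, hos, hodd, hon, x - (weilQuadratic o).re, sub_pos.2 hlt, ?_⟩
  intro e he hes hev hen
  have hxe : x ≤ (weilQuadratic e).re := stub_realEvenSuffices a x hb e he hes hev hen
  linarith

/-- The crux along this line (route `WeilParity` decl, by name), MODULO exactly the four registered
stubs (depends on `sorryAx` only through `stub_*`). [folklore] -/
theorem OffLineParityDetection_proof : OffLineParityDetection :=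
  OffLineParityDetection_of stub_evenOffLineLowerBound stub_simultaneousDirichlet
    stub_oddWinsAfterCommonPeriod stub_infiniteDefectDetection

/-! ### Calibration: COH-SYNC at `J = 1` contains the lead's TRIAL; the cut loses no strength -/

/-- **Converse bookkeeping** (sorry-free, as in the lead's skeleton): the crux implies the common
conclusion of `finiteDefectDetection_of` / INF for every off-line zero, so the detection stubs are the
crux restricted to the defect dichotomy (modulo REAL), not strengthenings of it. [folklore] -/
theorem detection_of_OffLineParityDetection (h : OffLineParityDetection) {ρ : ℂ}
    (hζ : riemannZeta ρ = 0) (h0 : 0 < ρ.re) (h1 : ρ.re < 1) (hne : ρ.re ≠ 1 / 2) :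
    ∃ a : ℝ, 0 < a ∧ ∃ x : ℝ, weilOddGroundEnergy a < x ∧
      ∀ e : ℝ → ℂ, IsWeilTest e → tsupport e ⊆ Set.Icc (-a) a → (∀ t, e (-t) = e t) →
        (∀ t, (e t).im = 0) → ∫ t, ‖e t‖ ^ 2 = (1 : ℝ) → x ≤ (weilQuadratic e).re := by
  obtain ⟨a, ha, o, ho, hos, hodd, hon, m, hm, hdet⟩ := h ρ hζ h0 h1 hne
  refine ⟨a, ha, (weilQuadratic o).re + m, ?_, fun e he hes hev _ hen ↦ hdet e he hes hev hen⟩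
  have hle : weilOddGroundEnergy a ≤ (weilQuadratic o).re := weilOddGroundEnergy_le ho hos hodd hon
  linarith

end Summit.RiemannHypothesis.RiemannHypothesis.Cruxes.OffLineParityDetection.DirichletCoherentWindow

end
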